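import Summits.AnomalousDissipation.AnomalousDissipation.Theorems.TwoAndHalfDTwohalfdThesisStubTwinEnstrophyCeiling
import Summits.AnomalousDissipation.AnomalousDissipation.Theorems.TwoAndHalfDTwohalfdThesisStubShellNoGo
import Literature.Analysis.FluidPDE.TorusForceBookkeeping

/-!
# Q5 `stub_nonselectiveNoGo` — a W-witness cannot relax its own torque pattern
# (line `Sketch`, crux stmt-AnomalousDissipation-0206)

Registered stub of the line `Sketch` (duhamel-release) for the crux
`Summit.AnomalousDissipation.AnomalousDissipation.Theses.TwoAndHalfD.TwohalfdThesis`
(stmt-AnomalousDissipation-0206), section Q (SELECTIVITY OF THE WITNESS'S MIXING) of the skeleton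
`Cruxes/TwohalfdThesis/Lines/Sketch.lean` — the ideators' typed target `NonselectiveNoGo`
(`Cruxes/TwohalfdThesis/NegativeNotesIdeator2R1g2.md` W10 (ii)), now a theorem at W's classical level.

* `releasedFamily_false_of_enstrophyCeiling` — THE DICHOTOMY ENGINE: a released family with a late loss
  (classical planar Navier–Stokes drifts with one steady force, `ν_j → 0`, classical releases of one smooth
  `h ≠ 0` losing a fixed fraction of `‖h‖²` by a fixed age from every late release time) cannot have a
  `j`-UNIFORM ceiling on its honest `limsup` mean enstrophy: the strain gate
  (`releasedFamily_meanStrain_ge`, G1-W ∘ G2) gives mean strain `≥ (δ‖h‖² log(1/ν_j)/C − 1)/τ₀ → ∞`,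
  Jensen (`longTimeAvgSup_sqrt_le_sqrt_add_one`) caps it by `√(R + 1)`.
* `stub_nonselectiveNoGo` — the registered statement: W's body plus a `j`-uniform integrable envelope
  for the classical releases of the TORQUE PATTERN `curl g` over the same flows is contradictory — by Q4
  `stub_twinEnstrophyCeiling` (p146323; vorticity twin Q1 p143927 + Duhamel with datum Q2 p144767 + Q3 p145693) the torque envelope is a uniform
  enstrophy ceiling `M'²‖curl g‖²`.  Reading: an X-witness flow is a SELECTIVE enhancer — it relaxes `h`
  in `O(1)` time uniformly in `ν`, but never its own torque pattern.
* `releasedFamily_torqueMemory` — the quantitative form: along a W-family, the `L¹`-mass `M'_j` of ANY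
  envelope of the `j`-th member's torque releases obeys `a·log(1/ν_j) − b ≤ M'_j‖curl g‖₂` eventually
  (`a = δ‖h‖²/(Cτ₀) > 0`): torque patterns stay correlated for `≳ log(1/ν_j)` release times.
* `releasedMixingWitness_false_of_coscalar` — the co-scalar exclusion at W-level: W's body with
  `h = c·curl g` is contradictory for every `c : ℝ` (for `c ≠ 0` the `h`-envelope IS a torque envelope;
  `c = 0` kills the Green–Kubo floor).  The sibling negative crux has the Leray–Hopf version
  (`TwohalfdNeg.Coscalar`, stmt-0211); here it is a two-line corollary of selectivity.
Supports stmt-AnomalousDissipation-0206. [folklore: Crippa–De Lellis 2008 / Seis 2022 (log gate); Duhamel; Majda–Bertozzi 2002 §2.1]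
-/

noncomputable section

-- the summit path `AnomalousDissipation/AnomalousDissipation` duplicates a namespace component
set_option linter.dupNamespace false

namespace Summit.AnomalousDissipation.AnomalousDissipation.Theorems.TwohalfdThesis

open MeasureTheory Set Filter Topology
open scoped ENNReal NNReal InnerProductSpace
open Literature.Analysis.FunctionSpaces Literature.Analysis.FluidPDE

/-- Local notation: the flat two-torus. -/
local notation "𝕋²" => UnitAddTorus (Fin 2)
/-- Local notation: planar velocity values. -/
local notation "E²" => EuclideanSpace ℝ (Fin 2)

/-! ## The dichotomy engine: late loss versus a uniform enstrophy ceiling -/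

section Family

variable {ν : ℕ → ℝ} {g : 𝕋² → E²} {v : ℕ → ℝ → 𝕋² → E²} {p : ℕ → ℝ → 𝕋² → ℝ}
  {h : 𝕋² → ℝ} {φ : ℕ → ℝ → ℝ → 𝕋² → ℝ} {s₀ τ₀ δ : ℝ}

/-- **Late loss versus enstrophy ceiling (the dichotomy engine).**  Classical planar Navier–Stokes drifts
`v_j` with ONE steady smooth mean-zero force `g` and viscosities `ν_j → 0⁺`, classical releases `φ j s` of
one smooth `h` with `‖h‖² > 0` at every `s ≥ 0`, losing the fraction `δ > 0` of `‖h‖²` by age `τ₀ > 0` from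
every `s ≥ s₀`: then NO real `R` bounds the honest `limsup` mean enstrophy of every member — the strain gate
gives mean strain `≥ (δ‖h‖² log(1/ν_j)/C − 1)/τ₀` for `ν_j ≤ κ₀`, Jensen caps it by `√(R+1)`, and
`log(1/ν_j) → ∞`. [folklore] -/
theorem releasedFamily_false_of_enstrophyCeiling (hν : ∀ j, 0 < ν j) (hν0 : Tendsto ν atTop (𝓝 0))
    (hg : Torus.IsSmooth g) (hgz : Torus.HasZeroMean g)
    (hNS : ∀ j, Torus.IsClassicalNSSolutionOn (Ici 0) (ν j) (fun _ => g) (v j) (p j))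
    (hh : Torus.IsSmooth h) (hh0 : 0 < Torus.scalarL2Sq h) (hτ₀ : 0 < τ₀) (hδ : 0 < δ)
    (hrel : ∀ j s, 0 ≤ s → Torus.IsClassicalScalarTransportOn (Ici s) (ν j) (v j) (φ j s) ∧ φ j s s = h)
    (hs₀ : 0 ≤ s₀)
    (hloss : ∀ j s, s₀ ≤ s → Torus.scalarL2Sq (φ j s (s + τ₀)) ≤ (1 - δ) * Torus.scalarL2Sq h)
    {R : ℝ} (hceil : ∀ j, longTimeAvgSup (fun t => (Torus.eGradNormSq (v j t)).toReal) ≤ R) : False := by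
  -- the mean-strain floor (G1-W ∘ G2)
  obtain ⟨κ₀, C, hκ₀, -, hC, hmean⟩ := releasedFamily_meanStrain_ge hν hg hgz hNS hh hτ₀ hrel hs₀ hloss
  -- the mean-strain ceiling (Jensen over the enstrophy ceiling)
  set B : ℝ := Real.sqrt (R + 1) with hB
  have hceil' : ∀ j, longTimeAvgSup (fun t => Real.sqrt (Torus.eGradNormSq (v j t)).toReal) ≤ B := fun j =>
    longTimeAvgSup_sqrt_le_sqrt_add_one (hν j) (hg.memLp 2) hgz
      (isGlobalLerayHopf_of_isClassicalNSSolutionOn_Ici (hNS j)) (hceil j)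
  -- contradiction as `log(1/ν_j) → ∞`
  have hpos : 0 < δ * Torus.scalarL2Sq h := mul_pos hδ hh0
  have hev1 : ∀ᶠ j in atTop, ν j ≤ κ₀ := hν0.eventually_le_const hκ₀
  have hev2 : ∀ᶠ j in atTop, (C * (τ₀ * B + 1) + C) / (δ * Torus.scalarL2Sq h) ≤ Real.log (ν j)⁻¹ :=
    (tendsto_log_inv_atTop_of_tendsto_zero hν hν0).eventually_ge_atTop _
  obtain ⟨j, hj1, hj2⟩ := (hev1.and hev2).exists
  have hm := (hmean j hj1).trans (hceil' j)
  rw [div_le_iff₀ hτ₀, sub_le_iff_le_add, div_le_iff₀ hC] at hm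
  rw [div_le_iff₀ hpos] at hj2
  have hB0 : 0 ≤ B := Real.sqrt_nonneg _
  nlinarith

/-- **Torque memory (quantitative selectivity), family form.**  Under the hypotheses of
`releasedFamily_false_of_enstrophyCeiling` except the ceiling, if `R_j ≥ 0` bounds the `j`-th member's honest
`limsup` mean enstrophy then `a·log(1/ν_j) − b ≤ √(R_j)` eventually, with `a = δ‖h‖²/(Cτ₀) > 0`,
`b = 1/τ₀ + 1` (the constants of the strain gate). [folklore] -/
theorem releasedFamily_log_le_sqrt_enstrophyCeiling (hν : ∀ j, 0 < ν j) (hν0 : Tendsto ν atTop (𝓝 0))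
    (hg : Torus.IsSmooth g) (hgz : Torus.HasZeroMean g)
    (hNS : ∀ j, Torus.IsClassicalNSSolutionOn (Ici 0) (ν j) (fun _ => g) (v j) (p j))
    (hh : Torus.IsSmooth h) (hh0 : 0 < Torus.scalarL2Sq h) (hτ₀ : 0 < τ₀) (hδ : 0 < δ)
    (hrel : ∀ j s, 0 ≤ s → Torus.IsClassicalScalarTransportOn (Ici s) (ν j) (v j) (φ j s) ∧ φ j s s = h)
    (hs₀ : 0 ≤ s₀)
    (hloss : ∀ j s, s₀ ≤ s → Torus.scalarL2Sq (φ j s (s + τ₀)) ≤ (1 - δ) * Torus.scalarL2Sq h)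
    {Rj : ℕ → ℝ} (hR0 : ∀ j, 0 ≤ Rj j)
    (hceil : ∀ j, longTimeAvgSup (fun t => (Torus.eGradNormSq (v j t)).toReal) ≤ Rj j) :
    ∃ a b : ℝ, 0 < a ∧ ∀ᶠ j in atTop, a * Real.log (ν j)⁻¹ - b ≤ Real.sqrt (Rj j) := by
  obtain ⟨κ₀, C, hκ₀, -, hC, hmean⟩ := releasedFamily_meanStrain_ge hν hg hgz hNS hh hτ₀ hrel hs₀ hloss
  refine ⟨δ * Torus.scalarL2Sq h / (C * τ₀), 1 / τ₀ + 1, by positivity, ?_⟩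
  filter_upwards [hν0.eventually_le_const hκ₀] with j hj
  have hceil' : longTimeAvgSup (fun t => Real.sqrt (Torus.eGradNormSq (v j t)).toReal) ≤ Real.sqrt (Rj j + 1) :=
    longTimeAvgSup_sqrt_le_sqrt_add_one (hν j) (hg.memLp 2) hgz
      (isGlobalLerayHopf_of_isClassicalNSSolutionOn_Ici (hNS j)) (hceil j)
  have hm := (hmean j hj).trans hceil'
  -- `√(R + 1) ≤ √R + 1`
  have hsqrt : Real.sqrt (Rj j + 1) ≤ Real.sqrt (Rj j) + 1 := by
    rw [Real.sqrt_le_left (by positivity)]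
    nlinarith [Real.sq_sqrt (hR0 j), Real.sqrt_nonneg (Rj j)]
  have e : δ * Torus.scalarL2Sq h / (C * τ₀) * Real.log (ν j)⁻¹ - (1 / τ₀ + 1) =
      (δ * Torus.scalarL2Sq h * Real.log (ν j)⁻¹ / C - 1) / τ₀ - 1 := by
    field_simp
    ring
  rw [e]
  linarith

end Family

/-! ## Q5: the non-selective no-go -/

/-- The Green–Kubo floor of W forces `‖h‖² > 0` (with `h = 0` every release pairing vanishes). [folklore] -/
theorem scalarL2Sq_pos_of_gkFloor {h : 𝕋² → ℝ} {φ : ℕ → ℝ → ℝ → 𝕋² → ℝ} {ε : ℝ}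
    (hhs : Torus.IsSmooth h) (hε : 0 < ε)
    (hGK : ∀ j, ε ≤ liminf (timeMean fun t => ∫ s in (0 : ℝ)..t, ∫ x, h x * φ j s t x) atTop) :
    0 < Torus.scalarL2Sq h := by
  -- adapted from the proof of `stub_shellNoGo`
  by_contra hcon
  have hzero : h = 0 := by
    by_contra hne
    exact hcon (scalarL2Sq_pos_of_ne_zero hhs hne)
  have h1 := hGK 0
  have hconst : (timeMean fun t => ∫ s in (0 : ℝ)..t, ∫ x, h x * φ 0 s t x) = fun _ => 0 := by
    funext T
    simp [timeMean, hzero]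
  rw [hconst, liminf_const] at h1
  exact absurd h1 (not_le.2 hε)

/-- An integrable envelope has a lossy lag with loss `δ = 3/4` from every late release
(`exists_pos_lag_le_half`: `Λ(τ₀) ≤ 1/2`). [folklore] -/
theorem exists_lossyLag_of_envelope {φ : ℕ → ℝ → ℝ → 𝕋² → ℝ} {h : 𝕋² → ℝ} {Λ : ℝ → ℝ} {s₀ : ℝ}
    (hh0 : 0 ≤ Torus.scalarL2Sq h) (hΛ0 : ∀ τ, 0 ≤ Λ τ) (hΛi : IntegrableOn Λ (Ici 0))
    (henv : ∀ j s t, s₀ ≤ s → s ≤ t → Torus.scalarL2Sq (φ j s t) ≤ Λ (t - s) ^ 2 * Torus.scalarL2Sq h) :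
    ∃ τ₀ : ℝ, 0 < τ₀ ∧ ∀ j s, s₀ ≤ s →
      Torus.scalarL2Sq (φ j s (s + τ₀)) ≤ (1 - 3 / 4) * Torus.scalarL2Sq h := by
  -- adapted from the proof of `stub_shellNoGo`
  obtain ⟨τ₀, hτ₀, hΛτ⟩ := exists_pos_lag_le_half hΛi
  refine ⟨τ₀, hτ₀, fun j s hs => ?_⟩
  have h1 := henv j s (s + τ₀) hs (by linarith)
  rw [add_sub_cancel_left] at h1
  have hΛsq : Λ τ₀ ^ 2 ≤ 1 / 4 := by nlinarith [hΛ0 τ₀]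
  calc Torus.scalarL2Sq (φ j s (s + τ₀)) ≤ Λ τ₀ ^ 2 * Torus.scalarL2Sq h := h1
    _ ≤ (1 / 4) * Torus.scalarL2Sq h := mul_le_mul_of_nonneg_right hΛsq hh0
    _ = (1 - 3 / 4) * Torus.scalarL2Sq h := by norm_num

/-- **The non-selective no-go (core statement; the registered stub `stub_nonselectiveNoGo` below repeats it
verbatim).**  W's body (one steady force `g`, `ν_j → 0`, classical planar Navier–Stokes family, pointwise energy
ceiling, classical releases of `h` with a `j`-uniform integrable envelope after `s₀`, Green–Kubo floor `ε > 0`)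
plus a `j`-uniform integrable envelope for the classical releases of the torque pattern `curl g` (from any
`s₁ ≥ 0`) is contradictory: Q4 turns the torque envelope into the uniform enstrophy ceiling `M'²‖curl g‖²`, the
floor gives `h ≠ 0`, the `h`-envelope has a lossy lag, and `releasedFamily_false_of_enstrophyCeiling` closes. [folklore] -/
theorem nonselectiveNoGo :
    ∀ (g : (UnitAddTorus (Fin 2)) → (EuclideanSpace ℝ (Fin 2))) (h : (UnitAddTorus (Fin 2)) → ℝ),
      Torus.IsSmooth g → Torus.IsDivFree g → Torus.HasZeroMean g → Torus.IsSmooth h → Torus.HasZeroMean h →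
      ∀ (ν : ℕ → ℝ) (v : ℕ → ℝ → (UnitAddTorus (Fin 2)) → (EuclideanSpace ℝ (Fin 2))) (p : ℕ → ℝ → (UnitAddTorus (Fin 2)) → ℝ) (φ : ℕ → ℝ → ℝ → (UnitAddTorus (Fin 2)) → ℝ)
        (Λ : ℝ → ℝ) (E s₀ M ε : ℝ),
        (∀ j, 0 < ν j) → Tendsto ν atTop (𝓝 0) →
        (∀ j, Torus.IsClassicalNSSolutionOn (Ici 0) (ν j) (fun _ => g) (v j) (p j)) →
        (∀ j t, 0 ≤ t → ∫ x, ‖v j t x‖ ^ 2 ≤ E) →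
        (∀ j s, 0 ≤ s → Torus.IsClassicalScalarTransportOn (Ici s) (ν j) (v j) (φ j s) ∧ φ j s s = h) →
        0 ≤ s₀ → (∀ τ, 0 ≤ Λ τ) → IntegrableOn Λ (Ici 0) → (∫ τ in Ici 0, Λ τ) ≤ M →
        (∀ j s t, s₀ ≤ s → s ≤ t → Torus.scalarL2Sq (φ j s t) ≤ Λ (t - s) ^ 2 * Torus.scalarL2Sq h) →
        0 < ε →
        (∀ j, ε ≤ liminf (timeMean fun t => ∫ s in (0 : ℝ)..t, ∫ x, h x * φ j s t x) atTop) →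
        ∀ (ψ : ℕ → ℝ → ℝ → (UnitAddTorus (Fin 2)) → ℝ) (Λ' : ℝ → ℝ) (s₁ M' : ℝ),
          0 ≤ s₁ →
          (∀ j s, s₁ ≤ s → Torus.IsClassicalScalarTransportOn (Ici s) (ν j) (v j) (ψ j s) ∧
              ψ j s s = fun x => Torus.partialDeriv 0 g x 1 - Torus.partialDeriv 1 g x 0) →
          (∀ τ, 0 ≤ Λ' τ) → IntegrableOn Λ' (Ici 0) → (∫ τ in Ici 0, Λ' τ) ≤ M' →
          (∀ j s t, s₁ ≤ s → s ≤ t → Torus.scalarL2Sq (ψ j s t) ≤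
              Λ' (t - s) ^ 2 * Torus.scalarL2Sq (fun x => Torus.partialDeriv 0 g x 1 - Torus.partialDeriv 1 g x 0)) →
          False := by
  intro g h hgs _hgd hgz hhs _hhz ν v p φ Λ E s₀ M ε hν hν0 hNS _hE hrel hs₀ hΛ0 hΛi _hΛM henv hε hGK
    ψ Λ' s₁ M' hs₁ hψ hΛ'0 hΛ'i hΛ'M henv'
  -- `h ≠ 0` by the Green–Kubo floor; a lossy lag for the `h`-releases
  have hh0 : 0 < Torus.scalarL2Sq h := scalarL2Sq_pos_of_gkFloor hhs hε hGK
  obtain ⟨τ₀, hτ₀, hloss⟩ := exists_lossyLag_of_envelope hh0.le hΛ0 hΛi henv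
  -- Q4: the torque envelope is a uniform enstrophy ceiling
  set R : ℝ := M' ^ 2 * Torus.scalarL2Sq (fun x => Torus.partialDeriv 0 g x 1 - Torus.partialDeriv 1 g x 0) with hR
  have hceil : ∀ j, longTimeAvgSup (fun t => (Torus.eGradNormSq (v j t)).toReal) ≤ R := fun j =>
    stub_twinEnstrophyCeiling (ν j) s₁ M' g (v j) (p j) (ψ j) Λ' (hν j) hgs (hNS j) hs₁ (hψ j) hΛ'0 hΛ'i hΛ'M
      (henv' j)
  exact releasedFamily_false_of_enstrophyCeiling hν hν0 hgs hgz hNS hhs hh0 hτ₀ (by norm_num) hrel hs₀ hloss hceil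

/-! ## Corollaries: torque memory and the co-scalar exclusion -/

/-- **Torque memory (quantitative selectivity).**  Along a family as in W (one steady force `g`, `ν_j → 0`,
classical releases of `h` with a uniform integrable envelope after `s₀`, Green–Kubo floor `ε > 0`; the energy
ceiling is not needed), let the classical releases `ψ j s` of the torque pattern `curl g` from `s ≥ s₁` carry,
member by member, integrable envelopes `Λ'_j ≥ 0` of mass `≤ M'_j`.  Then `a·log(1/ν_j) − b ≤ M'_j‖curl g‖₂`
eventually, for some `a > 0`: the torque pattern of the `j`-th member stays correlated for `≳ log(1/ν_j)`
release times (Q4 member by member + `releasedFamily_log_le_sqrt_enstrophyCeiling`). [folklore] -/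
theorem releasedFamily_torqueMemory
    (g : 𝕋² → E²) (h : 𝕋² → ℝ) (hgs : Torus.IsSmooth g) (hgz : Torus.HasZeroMean g) (hhs : Torus.IsSmooth h)
    (ν : ℕ → ℝ) (v : ℕ → ℝ → 𝕋² → E²) (p : ℕ → ℝ → 𝕋² → ℝ) (φ : ℕ → ℝ → ℝ → 𝕋² → ℝ) (Λ : ℝ → ℝ) (s₀ ε : ℝ)
    (hν : ∀ j, 0 < ν j) (hν0 : Tendsto ν atTop (𝓝 0))
    (hNS : ∀ j, Torus.IsClassicalNSSolutionOn (Ici 0) (ν j) (fun _ => g) (v j) (p j))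
    (hrel : ∀ j s, 0 ≤ s → Torus.IsClassicalScalarTransportOn (Ici s) (ν j) (v j) (φ j s) ∧ φ j s s = h)
    (hs₀ : 0 ≤ s₀) (hΛ0 : ∀ τ, 0 ≤ Λ τ) (hΛi : IntegrableOn Λ (Ici 0))
    (henv : ∀ j s t, s₀ ≤ s → s ≤ t → Torus.scalarL2Sq (φ j s t) ≤ Λ (t - s) ^ 2 * Torus.scalarL2Sq h)
    (hε : 0 < ε) (hGK : ∀ j, ε ≤ liminf (timeMean fun t => ∫ s in (0 : ℝ)..t, ∫ x, h x * φ j s t x) atTop)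
    (ψ : ℕ → ℝ → ℝ → 𝕋² → ℝ) (Λ' : ℕ → ℝ → ℝ) (M' : ℕ → ℝ) (s₁ : ℝ) (hs₁ : 0 ≤ s₁)
    (hψ : ∀ j s, s₁ ≤ s → Torus.IsClassicalScalarTransportOn (Ici s) (ν j) (v j) (ψ j s) ∧
      ψ j s s = fun x => Torus.partialDeriv 0 g x 1 - Torus.partialDeriv 1 g x 0)
    (hΛ'0 : ∀ j τ, 0 ≤ Λ' j τ) (hΛ'i : ∀ j, IntegrableOn (Λ' j) (Ici 0)) (hΛ'M : ∀ j, (∫ τ in Ici 0, Λ' j τ) ≤ M' j)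
    (henv' : ∀ j s t, s₁ ≤ s → s ≤ t → Torus.scalarL2Sq (ψ j s t) ≤
      Λ' j (t - s) ^ 2 * Torus.scalarL2Sq (fun x => Torus.partialDeriv 0 g x 1 - Torus.partialDeriv 1 g x 0)) :
    ∃ a b : ℝ, 0 < a ∧ ∀ᶠ j in atTop, a * Real.log (ν j)⁻¹ - b ≤
      M' j * Real.sqrt (Torus.scalarL2Sq (fun x => Torus.partialDeriv 0 g x 1 - Torus.partialDeriv 1 g x 0)) := by
  set G : 𝕋² → ℝ := fun x => Torus.partialDeriv 0 g x 1 - Torus.partialDeriv 1 g x 0 with hG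
  have hh0 : 0 < Torus.scalarL2Sq h := scalarL2Sq_pos_of_gkFloor hhs hε hGK
  obtain ⟨τ₀, hτ₀, hloss⟩ := exists_lossyLag_of_envelope hh0.le hΛ0 hΛi henv
  have hM'0 : ∀ j, 0 ≤ M' j := fun j =>
    (setIntegral_nonneg measurableSet_Ici fun τ _ => hΛ'0 j τ).trans (hΛ'M j)
  have hceil : ∀ j, longTimeAvgSup (fun t => (Torus.eGradNormSq (v j t)).toReal) ≤ M' j ^ 2 * Torus.scalarL2Sq G :=
    fun j => stub_twinEnstrophyCeiling (ν j) s₁ (M' j) g (v j) (p j) (ψ j) (Λ' j) (hν j) hgs (hNS j) hs₁ (hψ j)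
      (hΛ'0 j) (hΛ'i j) (hΛ'M j) (henv' j)
  obtain ⟨a, b, ha, hev⟩ := releasedFamily_log_le_sqrt_enstrophyCeiling hν hν0 hgs hgz hNS hhs hh0 hτ₀
    (by norm_num : (0 : ℝ) < 3 / 4) hrel hs₀ hloss
    (fun j => mul_nonneg (sq_nonneg (M' j)) (Torus.scalarL2Sq_nonneg G)) hceil
  refine ⟨a, b, ha, ?_⟩
  filter_upwards [hev] with j hj
  rwa [Real.sqrt_mul (sq_nonneg _), Real.sqrt_sq (hM'0 j)] at hj

/-- Scaling a classical release: if `φ` solves `∂ₜφ + u·∇φ = κΔφ` classically on `S × T²` (`S` a set of unique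
differentiability), so does `c·φ` (linearity: `timeDerivWithin`, `gradient`, `laplacian` commute with constants).
[folklore] -/
theorem isClassicalScalarTransportOn_const_mul {S : Set ℝ} {κ : ℝ} {u : ℝ → 𝕋² → E²} {φ : ℝ → 𝕋² → ℝ}
    (hφ : Torus.IsClassicalScalarTransportOn S κ u φ) (hS : UniqueDiffOn ℝ S) (c : ℝ) :
    Torus.IsClassicalScalarTransportOn S κ u (fun t x => c * φ t x) := by
  refine ⟨hφ.smooth_velocity, ?_, fun t ht x => ?_, hφ.divFree⟩
  · have := hφ.smooth_scalar.const_smul c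
    simpa only [smul_eq_mul] using this
  have hφt : Torus.IsSmooth (φ t) := hφ.smooth_scalar.isSmooth_slice ht
  have hdt : Torus.timeDerivWithin S (fun t x => c * φ t x) t x = c * Torus.timeDerivWithin S φ t x :=
    ((hφ.smooth_scalar.hasDerivWithinAt_slice ht x).const_mul c).derivWithin (hS t ht)
  have hgrad : Torus.gradient (fun y => c * φ t y) x = c • Torus.gradient (φ t) x :=
    Torus.gradient_const_smul (hφt.isContDiff (by simp)) c x
  have hlap : Torus.laplacian (fun y => c * φ t y) x = c * Torus.laplacian (φ t) x :=
    Torus.laplacian_const_smul' (F := ℝ) hφt c x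
  have e := hφ.transport t ht x
  change Torus.timeDerivWithin S (fun t x => c * φ t x) t x + ⟪u t x, Torus.gradient (fun y => c * φ t y) x⟫_ℝ =
    κ * Torus.laplacian (fun y => c * φ t y) x
  rw [hdt, hgrad, hlap, real_inner_smul_right]
  linear_combination c * e

/-- `‖c·f‖²_{L²} = c²‖f‖²_{L²}`. [folklore] -/
theorem scalarL2Sq_const_mul (c : ℝ) (f : 𝕋² → ℝ) :
    Torus.scalarL2Sq (fun x => c * f x) = c ^ 2 * Torus.scalarL2Sq f := by
  unfold Torus.scalarL2Sq
  rw [← integral_const_mul]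
  refine integral_congr_ae (Eventually.of_forall fun x => ?_)
  simp only [mul_pow]

/-- **The co-scalar exclusion at W-level.**  The body of W with a source proportional to the torque pattern,
`h = c·curl g` (`c : ℝ`), is contradictory: for `c = 0` the Green–Kubo floor fails (`h = 0`); for `c ≠ 0` the
scaled releases `c⁻¹·φ j s` ARE classical releases of `curl g` with the SAME envelope, and Q5 applies.  (The
sibling negative crux `TwohalfdNeg` has the Leray–Hopf version, `TwohalfdNeg.Coscalar`; cf. the certified
perimeter "an X-witness has `h ∉ ℝ·curl g`".) [folklore] -/
theorem releasedMixingWitness_false_of_coscalar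
    (c : ℝ) (g : 𝕋² → E²) (h : 𝕋² → ℝ) (hgs : Torus.IsSmooth g) (hgd : Torus.IsDivFree g)
    (hgz : Torus.HasZeroMean g) (hhs : Torus.IsSmooth h) (hhz : Torus.HasZeroMean h)
    (hco : ∀ x, h x = c * (Torus.partialDeriv 0 g x 1 - Torus.partialDeriv 1 g x 0))
    (ν : ℕ → ℝ) (v : ℕ → ℝ → 𝕋² → E²) (p : ℕ → ℝ → 𝕋² → ℝ) (φ : ℕ → ℝ → ℝ → 𝕋² → ℝ) (Λ : ℝ → ℝ)
    (E s₀ M ε : ℝ) (hν : ∀ j, 0 < ν j) (hν0 : Tendsto ν atTop (𝓝 0))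
    (hNS : ∀ j, Torus.IsClassicalNSSolutionOn (Ici 0) (ν j) (fun _ => g) (v j) (p j))
    (hE : ∀ j t, 0 ≤ t → ∫ x, ‖v j t x‖ ^ 2 ≤ E)
    (hrel : ∀ j s, 0 ≤ s → Torus.IsClassicalScalarTransportOn (Ici s) (ν j) (v j) (φ j s) ∧ φ j s s = h)
    (hs₀ : 0 ≤ s₀) (hΛ0 : ∀ τ, 0 ≤ Λ τ) (hΛi : IntegrableOn Λ (Ici 0)) (hΛM : (∫ τ in Ici 0, Λ τ) ≤ M)
    (henv : ∀ j s t, s₀ ≤ s → s ≤ t → Torus.scalarL2Sq (φ j s t) ≤ Λ (t - s) ^ 2 * Torus.scalarL2Sq h)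
    (hε : 0 < ε) (hGK : ∀ j, ε ≤ liminf (timeMean fun t => ∫ s in (0 : ℝ)..t, ∫ x, h x * φ j s t x) atTop) :
    False := by
  set G : 𝕋² → ℝ := fun x => Torus.partialDeriv 0 g x 1 - Torus.partialDeriv 1 g x 0 with hG
  have hh0 : 0 < Torus.scalarL2Sq h := scalarL2Sq_pos_of_gkFloor hhs hε hGK
  -- `c ≠ 0` (else `h = 0`)
  have hc : c ≠ 0 := by
    rintro rfl
    have hzero : h = fun _ => 0 := funext fun x => by rw [hco x, zero_mul]
    rw [hzero] at hh0
    simp [Torus.scalarL2Sq] at hh0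
  have hhG : ∀ x, G x = c⁻¹ * h x := fun x => by rw [hco x, ← mul_assoc, inv_mul_cancel₀ hc, one_mul]
  -- the scaled `h`-releases are torque releases with the same envelope
  set ψ : ℕ → ℝ → ℝ → 𝕋² → ℝ := fun j s t x => c⁻¹ * φ j s t x with hψ
  have hψrel : ∀ j s, s₀ ≤ s → Torus.IsClassicalScalarTransportOn (Ici s) (ν j) (v j) (ψ j s) ∧ ψ j s s = G := by
    intro j s hs
    obtain ⟨h1, h2⟩ := hrel j s (hs₀.trans hs)
    refine ⟨isClassicalScalarTransportOn_const_mul h1 (uniqueDiffOn_Ici s) c⁻¹, funext fun x => ?_⟩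
    simp only [hψ, h2, hhG x]
  have hGsq : Torus.scalarL2Sq G = c⁻¹ ^ 2 * Torus.scalarL2Sq h := by
    rw [show G = fun x => c⁻¹ * h x from funext hhG, scalarL2Sq_const_mul]
  have henv' : ∀ j s t, s₀ ≤ s → s ≤ t → Torus.scalarL2Sq (ψ j s t) ≤ Λ (t - s) ^ 2 * Torus.scalarL2Sq G := by
    intro j s t hs hst
    have e1 : Torus.scalarL2Sq (ψ j s t) = c⁻¹ ^ 2 * Torus.scalarL2Sq (φ j s t) := scalarL2Sq_const_mul _ _
    rw [e1, hGsq, mul_left_comm]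
    exact mul_le_mul_of_nonneg_left (henv j s t hs hst) (sq_nonneg _)
  exact nonselectiveNoGo g h hgs hgd hgz hhs hhz ν v p φ Λ E s₀ M ε hν hν0 hNS hE hrel hs₀ hΛ0 hΛi hΛM henv hε
    hGK ψ Λ s₀ M hs₀ hψrel hΛ0 hΛi hΛM henv'

/-! ## The registered stub -/

/-- **Q5 `stub_nonselectiveNoGo` (line `Sketch` = duhamel-release, crux `TwoAndHalfD.TwohalfdThesis`; registered
signature) — THE NON-SELECTIVE NO-GO: a W-witness cannot relax its own torque pattern.**  The body of the
line's open witness W `stub_releasedMixingWitness` (classical planar Navier–Stokes family with ONE steady force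
`g`, pointwise energy `≤ E`, classical releases of `h` with a `j`-uniform integrable envelope after the spin-up
time, Green–Kubo floor `ε > 0`) together with a `j`-uniform integrable envelope for the classical releases of
the TORQUE PATTERN `curl g = ∂₀g₁ − ∂₁g₀` over the same flows (from any spin-up time `s₁ ≥ 0`) is
contradictory (`nonselectiveNoGo`).  So an X-witness flow is a SELECTIVE enhancer: it relaxes `h` in `O(1)`
time uniformly in `ν` but keeps its own torque pattern correlated for `≳ log(1/ν_j)`
(`releasedFamily_torqueMemory`), and `h ∈ ℝ·curl g` is excluded (`releasedMixingWitness_false_of_coscalar`). [folklore] -/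
theorem stub_nonselectiveNoGo :
    ∀ (g : (UnitAddTorus (Fin 2)) → (EuclideanSpace ℝ (Fin 2))) (h : (UnitAddTorus (Fin 2)) → ℝ),
      Torus.IsSmooth g → Torus.IsDivFree g → Torus.HasZeroMean g → Torus.IsSmooth h → Torus.HasZeroMean h →
      ∀ (ν : ℕ → ℝ) (v : ℕ → ℝ → (UnitAddTorus (Fin 2)) → (EuclideanSpace ℝ (Fin 2))) (p : ℕ → ℝ → (UnitAddTorus (Fin 2)) → ℝ) (φ : ℕ → ℝ → ℝ → (UnitAddTorus (Fin 2)) → ℝ)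
        (Λ : ℝ → ℝ) (E s₀ M ε : ℝ),
        (∀ j, 0 < ν j) → Tendsto ν atTop (𝓝 0) →
        (∀ j, Torus.IsClassicalNSSolutionOn (Ici 0) (ν j) (fun _ => g) (v j) (p j)) →
        (∀ j t, 0 ≤ t → ∫ x, ‖v j t x‖ ^ 2 ≤ E) →
        (∀ j s, 0 ≤ s → Torus.IsClassicalScalarTransportOn (Ici s) (ν j) (v j) (φ j s) ∧ φ j s s = h) →
        0 ≤ s₀ → (∀ τ, 0 ≤ Λ τ) → IntegrableOn Λ (Ici 0) → (∫ τ in Ici 0, Λ τ) ≤ M →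
        (∀ j s t, s₀ ≤ s → s ≤ t → Torus.scalarL2Sq (φ j s t) ≤ Λ (t - s) ^ 2 * Torus.scalarL2Sq h) →
        0 < ε →
        (∀ j, ε ≤ liminf (timeMean fun t => ∫ s in (0 : ℝ)..t, ∫ x, h x * φ j s t x) atTop) →
        ∀ (ψ : ℕ → ℝ → ℝ → (UnitAddTorus (Fin 2)) → ℝ) (Λ' : ℝ → ℝ) (s₁ M' : ℝ),
          0 ≤ s₁ →
          (∀ j s, s₁ ≤ s → Torus.IsClassicalScalarTransportOn (Ici s) (ν j) (v j) (ψ j s) ∧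
              ψ j s s = fun x => Torus.partialDeriv 0 g x 1 - Torus.partialDeriv 1 g x 0) →
          (∀ τ, 0 ≤ Λ' τ) → IntegrableOn Λ' (Ici 0) → (∫ τ in Ici 0, Λ' τ) ≤ M' →
          (∀ j s t, s₁ ≤ s → s ≤ t → Torus.scalarL2Sq (ψ j s t) ≤
              Λ' (t - s) ^ 2 * Torus.scalarL2Sq (fun x => Torus.partialDeriv 0 g x 1 - Torus.partialDeriv 1 g x 0)) →
          False :=
  nonselectiveNoGo

end Summit.AnomalousDissipation.AnomalousDissipation.Theorems.TwohalfdThesis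

end
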